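import Summits.QuantumFields.YangMills.Theorems.SmallFieldWideningLargeFieldMassRefinementTailGaussianRung
import HarnessLib

/-!
# Route `SmallFieldWidening`, crux r3 `LargeFieldMassRefinementTail` (stmt-QuantumFields-22884) — THE GAUSSIAN RUNG, part 2: THE LARGE-FIELD
# **MASS** OF EVERY HEIGHT (two-sided per-plaquette factor + union bound over the level-`s` torus)

Width seat `ym-line-sfw-p2-w2` gen 3 (2026-08-28); continuation of `…GaussianRung` (§§1–5: the weight of the `s`-fold (0.4)-averaged
plaquette, `Σ V² ≤ (L^{4−d})^s`, variance `≤ σ²L^s` and sub-Gaussian proxy `σ²L^s` in `d = 3`, one-sided factor `e^{−p²/2}`), split off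
for the 400-line rule.  Here, in `d = 3` and under the same sub-Gaussian hypothesis on the fine plaquette curls (`σ² = g_K² > 0`):

* `measureReal_abs_curl_linAvgIter_ge_le_T3` — TWO-SIDED per-plaquette factor: `ℙ{|plaq_s(y; μ, ν)| ≥ g_{K−s}·p} ≤ 2e^{−p²/2}`
  (`g_{K−s}² := σ²L^s`; both signs `±V y` of the weight are admissible coefficient vectors with the same `Σ V²`);
* ★★★ `measureReal_exists_abs_curl_linAvgIter_ge_le_T3` — THE HEIGHT-`s` LARGE-FIELD MASS: `ℙ{∃ (y; μ, ν): |plaq_s| ≥ g_{K−s}·p} ≤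
  2·|T^{(s)}|·d²·e^{−p²/2}`, `|T^{(s)}| = (2L^{m+K−s})^d`, for EVERY height `s ≤ m + K` and every volume — the shape of the registered stub
  `AvgTailPkg` / `T3BareTailProfile.AveragedTailAt` («Gibbs mass of {some height-`j` averaged plaquette ≥ θ(K−j)} ≤ q(K−j)») for the
  linearised field, with the explicit profile `q(i) = 2·9·(2L^{m+i})³·e^{−p(g_i)²/2}` once `p = p(g_i) = b₀(1 + log g_i⁻¹)^{p₀}` — summable and
  cutoff-uniform by the route's series bookkeeping (`LargeFieldMassRefinementTail.summable_term`, p577835).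

WHAT THIS IS NOT.  Not the interacting SU(2) law (Bałaban's (71) inside the RG densities — crux r3's open content, 2′χ); the Maxwell law
is not constructed (its sub-Gaussianity is the HYPOTHESIS `hsub`); crux r3 stays open; no summit is proved (rung R3 record only; the
Yang–Mills mass gap is untouched).

References: T. Bałaban, Commun. Math. Phys. 102 (1985) 255–275 [Balaban1985UV3] ((7) p.257, (71) p.273); CMP 109 (1987) 249–301
[Balaban1987RG1] ((0.4), (0.11) p.253).
-/

set_option autoImplicit false


namespace Summit.QuantumFields.YangMills.Theorems.SFWGaussianRung

open scoped BigOperators NNReal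
open MeasureTheory ProbabilityTheory
open Literature.MathematicalPhysics.QuantumFieldTheory.Balaban1983to89
open Summit.QuantumFields.YangMills.Theorems.AbelianEML

variable {P : Params} {Ω : Type*} [MeasurableSpace Ω]

/-- **Two-sided per-plaquette factor (`d = 3`)**: under the sub-Gaussian hypothesis (`σ² > 0`), `ℙ{|plaq_s(y; μ, ν)| ≥ g_{K−s}·p} ≤ 2e^{−p²/2}`,
`g_{K−s}² := σ²L^s`, for every height `s ≤ m + K`, every site and every volume (both signs of the weight `±V y` are admissible coefficient
vectors with the same `Σ V²`). [cite: Balaban1985UV3, (71) p.273] -/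
theorem measureReal_abs_curl_linAvgIter_ge_le_T3 (hd : P.d = 3) (Pr : Measure Ω) (A : Ω → PBond P 0 → ℝ) (μ ν : Fin P.d) {σ2 : ℝ≥0}
    (hσ : σ2 ≠ 0)
    (hsub : ∀ c : Site P 0 → ℝ, HasSubgaussianMGF (fun ω => ∑ p, c p * curlAt (A ω) p μ ν) (σ2 * (∑ p, c p ^ 2).toNNReal) Pr)
    {s : ℕ} (hs : s ≤ P.m + P.K) (y : Site P s) {pv : ℝ} (hpv : 0 ≤ pv) :
    Pr.real {ω | Real.sqrt ((σ2 : ℝ) * (P.L : ℝ) ^ s) * pv ≤ |curlAt (linAvgIter s (A ω)) y μ ν|} ≤ 2 * Real.exp (-pv ^ 2 / 2) := by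
  obtain ⟨V, -, -, hsq, hrep⟩ := exists_weight_sq hs μ ν
  set g2 : ℝ := (σ2 : ℝ) * (P.L : ℝ) ^ s with hg2def
  have hg2 : 0 < g2 := mul_pos (NNReal.coe_pos.mpr (pos_iff_ne_zero.mpr hσ)) (pow_pos (Nat.cast_pos.mpr P.L_pos) s)
  have hθ : 0 ≤ Real.sqrt g2 * pv := mul_nonneg (Real.sqrt_nonneg _) hpv
  -- the proxy of `±Σ V·curl` is `σ²·Σ V² ≤ σ²·L^s`
  have hconst : ((P.L : ℝ) ^ 2 / (P.L : ℝ) ^ P.d) ^ s * ((P.L : ℝ) ^ 2) ^ s = (P.L : ℝ) ^ s := by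
    rw [hd, ← mul_pow, show (P.L : ℝ) ^ 2 / (P.L : ℝ) ^ 3 * (P.L : ℝ) ^ 2 = P.L by field_simp]
  have h1 : ∑ p, V y p ^ 2 ≤ (P.L : ℝ) ^ s := hconst ▸ hsq y
  have hprox : ∀ c : Site P 0 → ℝ, (∑ p, c p ^ 2) ≤ (P.L : ℝ) ^ s →
      HasSubgaussianMGF (fun ω => ∑ p, c p * curlAt (A ω) p μ ν) (σ2 * (P.L : ℝ≥0) ^ s) Pr := by
    intro c hc
    refine hasSubgaussianMGF_mono (hsub c) (mul_le_mul_right ?_ σ2)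
    rw [← NNReal.coe_le_coe, Real.coe_toNNReal _ (Finset.sum_nonneg fun p _ => sq_nonneg _)]
    simpa using hc
  have hcoe : ((σ2 * (P.L : ℝ≥0) ^ s : ℝ≥0) : ℝ) = g2 := by push_cast; ring
  have hexp : -(Real.sqrt g2 * pv) ^ 2 / (2 * g2) = -pv ^ 2 / 2 := by
    rw [mul_pow, Real.sq_sqrt hg2.le]; field_simp
  -- upper tail with `c = V y`, lower tail with `c = −V y`
  have hup : Pr.real {ω | Real.sqrt g2 * pv ≤ curlAt (linAvgIter s (A ω)) y μ ν} ≤ Real.exp (-pv ^ 2 / 2) := by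
    have := (hprox (V y) h1).measure_ge_le hθ
    rw [hcoe, hexp] at this
    refine le_of_eq_of_le ?_ this
    congr 1; ext ω; simp only [Set.mem_setOf_eq, hrep (A ω) y]
  have hlo : Pr.real {ω | Real.sqrt g2 * pv ≤ -curlAt (linAvgIter s (A ω)) y μ ν} ≤ Real.exp (-pv ^ 2 / 2) := by
    have h1' : ∑ p, (fun p => -V y p) p ^ 2 ≤ (P.L : ℝ) ^ s := by simpa using h1
    have := (hprox (fun p => -V y p) h1').measure_ge_le hθ
    rw [hcoe, hexp] at this
    refine le_of_eq_of_le ?_ this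
    congr 1; ext ω
    simp only [Set.mem_setOf_eq, hrep (A ω) y, neg_mul, Finset.sum_neg_distrib]
  -- `{θ ≤ |X|} ⊆ {θ ≤ X} ∪ {θ ≤ −X}`
  have hsub' : {ω | Real.sqrt g2 * pv ≤ |curlAt (linAvgIter s (A ω)) y μ ν|} ⊆
      {ω | Real.sqrt g2 * pv ≤ curlAt (linAvgIter s (A ω)) y μ ν} ∪ {ω | Real.sqrt g2 * pv ≤ -curlAt (linAvgIter s (A ω)) y μ ν} := by
    intro ω hω
    simp only [Set.mem_setOf_eq, Set.mem_union] at hω ⊢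
    rcases le_or_gt 0 (curlAt (linAvgIter s (A ω)) y μ ν) with h0 | h0
    · left; rwa [abs_of_nonneg h0] at hω
    · right; rwa [abs_of_neg h0] at hω
  haveI : IsFiniteMeasure Pr := by
    have := (hprox (V y) h1).integrable_exp_mul 0
    simp only [zero_mul, Real.exp_zero] at this
    exact (integrable_const_iff.mp this).resolve_left one_ne_zero
  calc Pr.real {ω | Real.sqrt g2 * pv ≤ |curlAt (linAvgIter s (A ω)) y μ ν|}
      ≤ Pr.real ({ω | Real.sqrt g2 * pv ≤ curlAt (linAvgIter s (A ω)) y μ ν} ∪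
          {ω | Real.sqrt g2 * pv ≤ -curlAt (linAvgIter s (A ω)) y μ ν}) := measureReal_mono hsub'
    _ ≤ _ := measureReal_union_le _ _
    _ ≤ 2 * Real.exp (-pv ^ 2 / 2) := by linarith

/-- **★★★ THE LARGE-FIELD MASS OF HEIGHT `s`, GAUSSIAN INSTANCE (`d = 3`)** — the shape of the registered stub `AvgTailPkg` / `AveragedTailAt`
for the linearised field: under the sub-Gaussian hypothesis in every plane, the probability that SOME `s`-fold averaged plaquette of the
level-`s` torus exceeds `g_{K−s}·p` is at most `2·|T^{(s)}|·d²·e^{−p²/2}` (`|T^{(s)}| = (2L^{m+K−s})^d` sites), for every height `s ≤ m + K` and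
every volume; with `p = p(g_{K−s}) = b₀(1 + log g_{K−s}⁻¹)^{p₀}` this is the summable, cutoff-uniform profile of the route's series
bookkeeping (`LargeFieldMassRefinementTail.summable_term`). [cite: Balaban1985UV3, (7) p.257 and (71) p.273] -/
theorem measureReal_exists_abs_curl_linAvgIter_ge_le_T3 (hd : P.d = 3) (Pr : Measure Ω) (A : Ω → PBond P 0 → ℝ) {σ2 : ℝ≥0}
    (hσ : σ2 ≠ 0)
    (hsub : ∀ (μ ν : Fin P.d) (c : Site P 0 → ℝ),
      HasSubgaussianMGF (fun ω => ∑ p, c p * curlAt (A ω) p μ ν) (σ2 * (∑ p, c p ^ 2).toNNReal) Pr)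
    {s : ℕ} (hs : s ≤ P.m + P.K) {pv : ℝ} (hpv : 0 ≤ pv) :
    Pr.real {ω | ∃ (y : Site P s) (μ ν : Fin P.d), Real.sqrt ((σ2 : ℝ) * (P.L : ℝ) ^ s) * pv ≤ |curlAt (linAvgIter s (A ω)) y μ ν|} ≤
      2 * (Fintype.card (Site P s) * (P.d : ℝ) ^ 2) * Real.exp (-pv ^ 2 / 2) := by
  have hset : {ω | ∃ (y : Site P s) (μ ν : Fin P.d), Real.sqrt ((σ2 : ℝ) * (P.L : ℝ) ^ s) * pv ≤ |curlAt (linAvgIter s (A ω)) y μ ν|} =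
      ⋃ q : Site P s × (Fin P.d × Fin P.d), {ω | Real.sqrt ((σ2 : ℝ) * (P.L : ℝ) ^ s) * pv ≤ |curlAt (linAvgIter s (A ω)) q.1 q.2.1 q.2.2|} := by
    ext ω
    simp only [Set.mem_setOf_eq, Set.mem_iUnion, Prod.exists]
  rw [hset]
  refine (measureReal_iUnion_fintype_le _).trans ?_
  calc ∑ q : Site P s × (Fin P.d × Fin P.d), Pr.real {ω | Real.sqrt ((σ2 : ℝ) * (P.L : ℝ) ^ s) * pv ≤ |curlAt (linAvgIter s (A ω)) q.1 q.2.1 q.2.2|}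
      ≤ ∑ _q : Site P s × (Fin P.d × Fin P.d), 2 * Real.exp (-pv ^ 2 / 2) :=
        Finset.sum_le_sum fun q _ => measureReal_abs_curl_linAvgIter_ge_le_T3 hd Pr A q.2.1 q.2.2 hσ (hsub q.2.1 q.2.2) hs q.1 hpv
    _ = 2 * (Fintype.card (Site P s) * (P.d : ℝ) ^ 2) * Real.exp (-pv ^ 2 / 2) := by
        rw [Finset.sum_const, Finset.card_univ, nsmul_eq_mul, Fintype.card_prod, Fintype.card_prod, Fintype.card_fin]
        push_cast; ring

end Summit.QuantumFields.YangMills.Theorems.SFWGaussianRung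

/-! ## §7 Centred Gaussian laws: the covariance bound alone gives the sub-Gaussian hypothesis (APPEND, same seat) -/

namespace Summit.QuantumFields.YangMills.Theorems.SFWGaussianRung

open scoped BigOperators NNReal
open MeasureTheory ProbabilityTheory
open Literature.MathematicalPhysics.QuantumFieldTheory.Balaban1983to89
open Summit.QuantumFields.YangMills.Theorems.AbelianEML

variable {P : Params} {Ω : Type*} [MeasurableSpace Ω]

/-- **A centred real Gaussian variable is sub-Gaussian with parameter its variance** (equality of moment-generating functions). [folklore] -/
theorem hasSubgaussianMGF_of_hasGaussianLaw {Pr : Measure Ω} {X : Ω → ℝ} (hX : HasGaussianLaw X Pr) (h0 : ∫ ω, X ω ∂Pr = 0) :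
    HasSubgaussianMGF X (Var[X; Pr]).toNNReal Pr := by
  have hmap := hX.map_eq_gaussianReal
  refine ⟨fun t => ?_, fun t => ?_⟩
  · have hint := integrable_exp_mul_gaussianReal (μ := Pr[X]) (v := (Var[X; Pr]).toNNReal) t
    rw [← hmap] at hint
    exact (integrable_map_measure (by fun_prop) hX.aemeasurable).mp hint
  · rw [mgf_gaussianReal hmap t, h0, zero_mul, zero_add]

/-- The curl is additive in the one-form. [folklore] -/
theorem curlAt_add {j : ℕ} (a b : PBond P j → ℝ) (x : Site P j) (μ ν : Fin P.d) :
    curlAt (a + b) x μ ν = curlAt a x μ ν + curlAt b x μ ν := by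
  simp only [curlAt, Pi.add_apply]; ring

/-- The curl is homogeneous in the one-form. [folklore] -/
theorem curlAt_smul {j : ℕ} (r : ℝ) (a : PBond P j → ℝ) (x : Site P j) (μ ν : Fin P.d) :
    curlAt (r • a) x μ ν = r * curlAt a x μ ν := by
  simp only [curlAt, Pi.smul_apply, smul_eq_mul]; ring

/-- **A fixed linear combination of plaquette curls is a continuous linear functional of the one-form** (finite lattice). [folklore] -/
theorem exists_clm_curlComb (c : Site P 0 → ℝ) (μ ν : Fin P.d) :
    ∃ Lc : (PBond P 0 → ℝ) →L[ℝ] ℝ, ∀ a, Lc a = ∑ p, c p * curlAt a p μ ν := by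
  refine ⟨LinearMap.toContinuousLinearMap
    { toFun := fun a => ∑ p, c p * curlAt a p μ ν
      map_add' := fun a b => ?_
      map_smul' := fun r a => ?_ }, fun a => rfl⟩
  · simp only [curlAt_add, mul_add, Finset.sum_add_distrib]
  · simp only [curlAt_smul, RingHom.id_apply, smul_eq_mul, Finset.mul_sum]
    exact Finset.sum_congr rfl fun p _ => by ring

/-- **★★★ FOR A CENTRED GAUSSIAN LAW THE COVARIANCE BOUND IS THE WHOLE HYPOTHESIS**: if the fine one-form `A` has a centred Gaussian law
(`HasGaussianLaw A`, `∫ A = 0` — lattice Maxwell is the model) and its plaquette curls have covariance `≤ σ²·Id` in the plane `(μ, ν)`, then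
every fixed linear combination of the curls is sub-Gaussian with variance proxy `σ²·Σ c²` — the hypothesis `hsub` of §§5–6. [folklore] -/
theorem hsub_of_hasGaussianLaw (Pr : Measure Ω) (A : Ω → PBond P 0 → ℝ) (hA : HasGaussianLaw A Pr) (hA0 : ∫ ω, A ω ∂Pr = 0)
    (μ ν : Fin P.d) {σ2 : ℝ≥0}
    (hcov : ∀ c : Site P 0 → ℝ, variance (fun ω => ∑ p, c p * curlAt (A ω) p μ ν) Pr ≤ σ2 * ∑ p, c p ^ 2) (c : Site P 0 → ℝ) :
    HasSubgaussianMGF (fun ω => ∑ p, c p * curlAt (A ω) p μ ν) (σ2 * (∑ p, c p ^ 2).toNNReal) Pr := by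
  obtain ⟨Lc, hLc⟩ := exists_clm_curlComb c μ ν
  have hfun : (fun ω => ∑ p, c p * curlAt (A ω) p μ ν) = fun ω => Lc (A ω) := funext fun ω => (hLc (A ω)).symm
  have hG : HasGaussianLaw (fun ω => Lc (A ω)) Pr := hA.map_fun Lc
  have h0 : ∫ ω, Lc (A ω) ∂Pr = 0 := by
    rw [ContinuousLinearMap.integral_comp_comm Lc hA.integrable, hA0, map_zero]
  rw [hfun]
  refine hasSubgaussianMGF_mono (hasSubgaussianMGF_of_hasGaussianLaw hG h0) ?_
  rw [← NNReal.coe_le_coe, NNReal.coe_mul, Real.coe_toNNReal _ (Finset.sum_nonneg fun p _ => sq_nonneg _),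
    Real.coe_toNNReal _ (variance_nonneg _ _), ← hfun]
  exact hcov c

/-- **★★★ THE GAUSSIAN RUNG FOR CENTRED GAUSSIAN (MAXWELL-TYPE) LAWS, `d = 3`**: a centred Gaussian fine one-form whose plaquette curls have
covariance `≤ σ²·Id` in every plane (`σ² = g_K² > 0`) has, at EVERY height `s ≤ m + K` and in every volume, large-field mass
`ℙ{∃ (y; μ, ν): |plaq_s| ≥ g_{K−s}·p} ≤ 2·|T^{(s)}|·d²·e^{−p²/2}` (`g_{K−s}² := σ²L^s`) — the `AvgTailPkg`-shaped statement of part 2 with its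
sub-Gaussian hypothesis discharged. [cite: Balaban1985UV3, (7) p.257 and (71) p.273] -/
theorem measureReal_exists_abs_curl_linAvgIter_ge_le_T3_of_gaussian (hd : P.d = 3) (Pr : Measure Ω) (A : Ω → PBond P 0 → ℝ)
    (hA : HasGaussianLaw A Pr) (hA0 : ∫ ω, A ω ∂Pr = 0) {σ2 : ℝ≥0} (hσ : σ2 ≠ 0)
    (hcov : ∀ (μ ν : Fin P.d) (c : Site P 0 → ℝ), variance (fun ω => ∑ p, c p * curlAt (A ω) p μ ν) Pr ≤ σ2 * ∑ p, c p ^ 2)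
    {s : ℕ} (hs : s ≤ P.m + P.K) {pv : ℝ} (hpv : 0 ≤ pv) :
    Pr.real {ω | ∃ (y : Site P s) (μ ν : Fin P.d), Real.sqrt ((σ2 : ℝ) * (P.L : ℝ) ^ s) * pv ≤ |curlAt (linAvgIter s (A ω)) y μ ν|} ≤
      2 * (Fintype.card (Site P s) * (P.d : ℝ) ^ 2) * Real.exp (-pv ^ 2 / 2) :=
  measureReal_exists_abs_curl_linAvgIter_ge_le_T3 hd Pr A hσ (fun μ ν c => hsub_of_hasGaussianLaw Pr A hA hA0 μ ν (hcov μ ν) c) hs hpv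

end Summit.QuantumFields.YangMills.Theorems.SFWGaussianRung
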